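import Literature.NumberTheory.ModularForms.JacobiForms
import HarnessLib

/-!
# The index-raising operator `U_l` on Jacobi forms: `φ(τ, z) ↦ φ(τ, lz)`, `J_{k,m} → J_{k,ml²}`
# (Eichler–Zagier, Ch. I §4)

M. Eichler, D. Zagier, *The Theory of Jacobi Forms* (Progress in Mathematics 55, Birkhäuser 1985), Ch. I §4 "Hecke
operators" (not held — `acq-10245`): besides the Hecke operators `T_l` the section introduces the two operators
changing the index, `U_l : J_{k,m} → J_{k,ml²}`, `(φ|U_l)(τ, z) = φ(τ, lz)`, and `V_l : J_{k,m} → J_{k,ml}`,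
`(φ|V_l)(τ, z) = l^{k−1} Σ_{(a b; c d) ∈ Γ₁\M₂(ℤ), ad−bc = l} (cτ+d)^{−k} e^{ml}(−cz²/(cτ+d)) φ((aτ+b)/(cτ+d), lz/(cτ+d))`,
with the Fourier coefficients `c_{φ|U_l}(n, r) = c(n, r/l)` (`l ∣ r`, else `0`) and
`c_{φ|V_l}(n, r) = Σ_{a ∣ (n,r,l)} a^{k−1} c(nl/a², r/a)`.

Row g39-#11 of the `lit-hodgefound` lane (prover p25, generation 39), sequel of `JacobiForms.lean` (g39-#1).
THEOREMS ONLY: the operator `U_l` (the elementary one — (J-1), (J-2) at `(λl, μl)` and (J-3) transported along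
`(n, r) ↦ (n, lr)`); `V_l` (which needs the action of `SL₂(ℤ)` on `Γ₁\{det = l}`) is not here.

## What is proved

* `JacobiForm.hasSum_comp_mul_left` — reading a double Fourier series `Σ c(n, r) e^{2πi(nτ + rz)}` at `lz`:
  coefficients `c(n, r/l)` for `l ∣ r`, `0` otherwise (`l ≥ 1`).
* **`IsJacobiForm.comp_mul_left`** — `φ ∈ J_{k,m}`, `l ≥ 1` ⇒ `(τ, z) ↦ φ(τ, lz)` is in `J_{k,ml²}`.
* `comp_mul_left_mem_jacobiFormSpace` — the same on the spaces `jacobiFormSpace k m → jacobiFormSpace k (ml²)`.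

## References

* [EichlerZagier1985] M. Eichler, D. Zagier, *The Theory of Jacobi Forms*, Progress in Math. 55 (1985), Ch. I §4
  (the operators `U_l`, `V_l` and their Fourier coefficients).
-/

noncomputable section

open scoped Real MatrixGroups
open Complex Filter Topology
open UpperHalfPlane hiding I

namespace Literature.NumberTheory.ModularForms

variable {k : ℤ} {m : ℕ} {φ : ℂ → ℂ → ℂ}

/-- **Reading a double Fourier series at `lz`**: if `Σ c(n, r) e^{2πi(nτ + rz)} = φ(τ, z)` on `{Im τ > 0} × ℂ` then
`φ(τ, lz) = Σ c'(n, r) e^{2πi(nτ + rz)}` with `c'(n, r) = c(n, r/l)` for `l ∣ r` and `0` otherwise (`l ≥ 1`; transport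
along `(n, r) ↦ (n, lr)`). [cite: EichlerZagier1985, Ch. I §4 (the operator `U_l` and its Fourier coefficients)] -/
theorem JacobiForm.hasSum_comp_mul_left {c : ℤ → ℤ → ℂ} {φ : ℂ → ℂ → ℂ} {l : ℕ} (hl : 0 < l)
    (hc : ∀ τ z : ℂ, 0 < τ.im →
      HasSum (fun p : ℤ × ℤ => c p.1 p.2 * cexp (2 * π * I * (p.1 * τ + p.2 * z))) (φ τ z))
    {τ : ℂ} (hτ : 0 < τ.im) (z : ℂ) :
    HasSum (fun p : ℤ × ℤ => (if (l : ℤ) ∣ p.2 then c p.1 (p.2 / l) else 0) *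
      cexp (2 * π * I * (p.1 * τ + p.2 * z))) (φ τ (l * z)) := by
  have hl0' : (l : ℤ) ≠ 0 := by exact_mod_cast hl.ne'
  have hinj : Function.Injective (fun p : ℤ × ℤ => (p.1, (l : ℤ) * p.2)) := by
    intro p q hpq
    simp only [Prod.mk.injEq] at hpq
    exact Prod.ext hpq.1 (mul_left_cancel₀ hl0' hpq.2)
  have hzero : ∀ p : ℤ × ℤ, p ∉ Set.range (fun p : ℤ × ℤ => (p.1, (l : ℤ) * p.2)) →
      (fun p : ℤ × ℤ => (if (l : ℤ) ∣ p.2 then c p.1 (p.2 / l) else 0) *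
        cexp (2 * π * I * (p.1 * τ + p.2 * z))) p = 0 := by
    intro p hp
    have : ¬ (l : ℤ) ∣ p.2 := fun ⟨s, hs'⟩ => hp ⟨(p.1, s), Prod.ext rfl hs'.symm⟩
    simp [this]
  refine (hinj.hasSum_iff hzero).mp ?_
  refine (hc τ (l * z) hτ).congr_fun fun p => ?_
  simp only [Function.comp_apply, dvd_mul_right, if_true, Int.mul_ediv_cancel_left _ hl0']
  push_cast
  ring_nf

/-- **Eichler–Zagier's operator `U_l` (`l ≥ 1`): `φ ∈ J_{k,m} ⇒ φ|U_l := φ(τ, lz) ∈ J_{k,ml²}`**, with Fourier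
coefficients `c_{φ|U_l}(n, r) = c(n, r/l)` (`= 0` unless `l ∣ r`): (J-1) and (J-2) at `(λl, μl)` are those of `φ` read
at `lz`, and `r² ≤ 4mn ⇒ (lr)² ≤ 4(ml²)n`. [cite: EichlerZagier1985, Ch. I §4 (the operator `U_l`: `J_{k,m} → J_{k,ml²}`)] -/
theorem IsJacobiForm.comp_mul_left (h : IsJacobiForm k m φ) {l : ℕ} (hl : 0 < l) :
    IsJacobiForm k (m * l ^ 2) (fun τ z => φ τ (l * z)) where
  differentiableOn := by
    have hlin : Differentiable ℂ (fun p : ℂ × ℂ => (p.1, (l : ℂ) * p.2)) :=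
      differentiable_fst.prodMk (differentiable_snd.const_mul _)
    have hc := h.differentiableOn.comp hlin.differentiableOn (fun p hp => hp)
    exact hc
  modular γ τ z hτ := by
    have h1 := h.modular γ τ (l * z) hτ
    rw [show (l : ℂ) * (z / denom (γ : GL (Fin 2) ℝ) τ) = l * z / denom (γ : GL (Fin 2) ℝ) τ by ring, h1]
    push_cast
    ring_nf
  elliptic l' μ τ z hτ := by
    have h1 := h.elliptic (l' * l) (μ * l) τ (l * z) hτ
    rw [show (l : ℂ) * (z + l' * τ + μ) = l * z + ((l' * l : ℤ) : ℂ) * τ + ((μ * l : ℤ) : ℂ) by push_cast; ring, h1]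
    push_cast
    ring_nf
  hasSum_coeff := by
    obtain ⟨c, hc, hs⟩ := h.hasSum_coeff
    have hl0' : (l : ℤ) ≠ 0 := by exact_mod_cast hl.ne'
    refine ⟨fun n r => if (l : ℤ) ∣ r then c n (r / l) else 0, fun n r hnr => ?_,
      fun τ z hτ => JacobiForm.hasSum_comp_mul_left hl hs hτ z⟩
    dsimp only at hnr
    by_cases hlr : (l : ℤ) ∣ r
    · rw [if_pos hlr] at hnr
      obtain ⟨s, rfl⟩ := hlr
      rw [Int.mul_ediv_cancel_left _ hl0'] at hnr
      obtain ⟨h0, h2⟩ := hc n s hnr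
      refine ⟨h0, ?_⟩
      push_cast
      nlinarith [sq_nonneg (l : ℤ)]
    · rw [if_neg hlr] at hnr
      exact absurd rfl hnr

/-- `U_l` on the spaces: `φ ∈ J_{k,m} ⇒ ((τ, z) ↦ φ(τ, lz)) ∈ J_{k,ml²}` (`l ≥ 1`).
[cite: EichlerZagier1985, Ch. I §4 (the operator `U_l`)] -/
theorem comp_mul_left_mem_jacobiFormSpace (hφ : φ ∈ jacobiFormSpace k m) {l : ℕ} (hl : 0 < l) :
    (fun τ z => φ τ (l * z)) ∈ jacobiFormSpace k (m * l ^ 2) :=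
  ⟨hφ.1.comp_mul_left hl, fun τ z hτ => hφ.2 τ (l * z) hτ⟩

end Literature.NumberTheory.ModularForms
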